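import Mathlib.Topology.Baire.Lemmas
import Mathlib.Topology.Baire.CompleteMetrizable
import Literature.Geometry.Lorentzian.FinalState
import Literature.Geometry.Lorentzian.Genericity
import HarnessLib

/-!
# Route PhotonSphereChannels · crux `TameCensorship` (stmt-FinalStateConjecture-17431) · line `Sketch`, skeleton v9 ·
# stub `stub_residualMono`: RESIDUAL escapability is monotone in the property (def-free, abstract in Q Q')

Helper file (`--supports stmt-FinalStateConjecture-17431`) of line `Sketch` (lead c4, 2026-08-17, wave 2): one brick of the
RESIDUAL legend. Residual escapability of a property `Q` of initial data at a datum `d`: every compactly supported smooth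
admissible probe through `d` enriches, along an injective linear map of parameter spaces, to one along all of whose further
enrichments a RESIDUAL (comeagre, `residual (EuclideanSpace ℝ (Fin p))`, Mathlib `Topology/GDelta/Basic`) set of radial
directions has `Q` for all small non-zero parameters — the v9 weakening of the open-dense ("robust") legend of v4–v8.

What: residual escapability at `d` is MONOTONE in the property along implications `Q → Q'` that are only required to
hold on the admissible class `admissibleVacuumData X` (exact residual analogue of the landed `stub_robustMono`,
`Theorems/PhotonSphereChannelsTameCensorshipRobustMono.lean`; sibling of the `∧`-closure `stub_residualAnd`). Why: the
composition of the skeleton upgrades the residual form of one clause of K3 to a weaker (implied) clause, and the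
implication it has in hand is only valid for admissible data; this lemma is the glue. Proof: keep the enrichment
`(n, G₁, L)` and, for every further enrichment `(p, G₂, L')`, the same residual direction set `U` and the same radius
`δ`; a good parameter `t • v` for `Q` is good for `Q'` because the member `G₂ (t • v)` of the probe `G₂` is admissible
(third conjunct of the probe legend). Pure logic; no choice, no Baire-category argument beyond what the hypothesis
already provides (the filter `residual` is only carried along, never unfolded). [folklore]
-/

set_option linter.dupNamespace false

open Literature.Geometry.Lorentzian
open scoped Manifold ContDiff Topology
open Filter Set Function

noncomputable section

namespace Summit.FinalStateConjecture.FinalStateConjecture.Theorems.PhotonSphereChannels.TameCensorshipUnwind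

/-- **Stub `stub_residualMono` of line `Sketch` (skeleton v9) for the crux `PhotonSphereChannels.TameCensorship`
(stmt-FinalStateConjecture-17431): residual escapability is MONOTONE in the property.** For an arbitrary datum `d` and
two properties `Q`, `Q'` of initial data with `Q D → Q' D` for every ADMISSIBLE datum `D`: if every compactly supported
smooth admissible probe through `d` enriches (along an injective linear map of parameter spaces) to one along all of
whose further enrichments a residual (comeagre) set of radial directions has `Q` for all small non-zero parameters, then
the same holds with `Q'` in place of `Q`. Proof idea: take the same enrichment, the same residual set of directions and
the same radius; every member `G₂ (t • v)` of a probe lies in `admissibleVacuumData X` (third conjunct of the probe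
legend), so the implication `Q → Q'` applies to it. Stated DEF-FREE (the registered stub signature inlines the probe
legend) so that it does not depend on the skeleton's local definitions. [folklore] -/
theorem stub_residualMono :
    ∀ (X : Type) [TopologicalSpace X] [ChartedSpace E3 X] [IsManifold (𝓡 3) ∞ X] [T2Space X]
    [SecondCountableTopology X] [ConnectedSpace X] (d : InitialDataSet (𝓡 3) X) (Q Q' : InitialDataSet (𝓡 3) X →
    Prop), (∀ D ∈ admissibleVacuumData X, Q D → Q' D) → (∀ (m : ℕ) (G : EuclideanSpace ℝ (Fin m) →
    InitialDataSet (𝓡 3) X), (InitialDataSet.IsSmoothDataFamily m G ∧ G 0 = d ∧ (∀ c, G c ∈ admissibleVacuumData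
    X) ∧ ∃ K : Set X, IsCompact K ∧ ∀ c, ∀ x ∉ K, (G c).h.inner x = d.h.inner x ∧ (G c).k x = d.k x) → ∃ (n : ℕ)
    (G₁ : EuclideanSpace ℝ (Fin n) → InitialDataSet (𝓡 3) X) (L : EuclideanSpace ℝ (Fin m) →ₗ[ℝ] EuclideanSpace
    ℝ (Fin n)), Function.Injective L ∧ (InitialDataSet.IsSmoothDataFamily n G₁ ∧ G₁ 0 = d ∧ (∀ c, G₁ c ∈
    admissibleVacuumData X) ∧ ∃ K : Set X, IsCompact K ∧ ∀ c, ∀ x ∉ K, (G₁ c).h.inner x = d.h.inner x ∧ (G₁ c).k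
    x = d.k x) ∧ (∀ c, G₁ (L c) = G c) ∧ ∀ (p : ℕ) (G₂ : EuclideanSpace ℝ (Fin p) → InitialDataSet (𝓡 3) X) (L'
    : EuclideanSpace ℝ (Fin n) →ₗ[ℝ] EuclideanSpace ℝ (Fin p)), Function.Injective L' →
    (InitialDataSet.IsSmoothDataFamily p G₂ ∧ G₂ 0 = d ∧ (∀ c, G₂ c ∈ admissibleVacuumData X) ∧ ∃ K : Set X,
    IsCompact K ∧ ∀ c, ∀ x ∉ K, (G₂ c).h.inner x = d.h.inner x ∧ (G₂ c).k x = d.k x) → (∀ c, G₂ (L' c) = G₁ c) →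
    ∃ U : Set (EuclideanSpace ℝ (Fin p)), U ∈ residual (EuclideanSpace ℝ (Fin p)) ∧ ∀ v ∈ U, ∃ δ : ℝ, 0 < δ ∧ ∀
    t : ℝ, t ≠ 0 → |t| < δ → Q (G₂ (t • v))) → ∀ (m : ℕ) (G : EuclideanSpace ℝ (Fin m) → InitialDataSet (𝓡 3)
    X), (InitialDataSet.IsSmoothDataFamily m G ∧ G 0 = d ∧ (∀ c, G c ∈ admissibleVacuumData X) ∧ ∃ K : Set X,
    IsCompact K ∧ ∀ c, ∀ x ∉ K, (G c).h.inner x = d.h.inner x ∧ (G c).k x = d.k x) → ∃ (n : ℕ) (G₁ :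
    EuclideanSpace ℝ (Fin n) → InitialDataSet (𝓡 3) X) (L : EuclideanSpace ℝ (Fin m) →ₗ[ℝ] EuclideanSpace ℝ (Fin
    n)), Function.Injective L ∧ (InitialDataSet.IsSmoothDataFamily n G₁ ∧ G₁ 0 = d ∧ (∀ c, G₁ c ∈
    admissibleVacuumData X) ∧ ∃ K : Set X, IsCompact K ∧ ∀ c, ∀ x ∉ K, (G₁ c).h.inner x = d.h.inner x ∧ (G₁ c).k
    x = d.k x) ∧ (∀ c, G₁ (L c) = G c) ∧ ∀ (p : ℕ) (G₂ : EuclideanSpace ℝ (Fin p) → InitialDataSet (𝓡 3) X) (L'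
    : EuclideanSpace ℝ (Fin n) →ₗ[ℝ] EuclideanSpace ℝ (Fin p)), Function.Injective L' →
    (InitialDataSet.IsSmoothDataFamily p G₂ ∧ G₂ 0 = d ∧ (∀ c, G₂ c ∈ admissibleVacuumData X) ∧ ∃ K : Set X,
    IsCompact K ∧ ∀ c, ∀ x ∉ K, (G₂ c).h.inner x = d.h.inner x ∧ (G₂ c).k x = d.k x) → (∀ c, G₂ (L' c) = G₁ c) →
    ∃ U : Set (EuclideanSpace ℝ (Fin p)), U ∈ residual (EuclideanSpace ℝ (Fin p)) ∧ ∀ v ∈ U, ∃ δ : ℝ, 0 < δ ∧ ∀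
    t : ℝ, t ≠ 0 → |t| < δ → Q' (G₂ (t • v)) := by
  -- adapted from `stub_robustMono` (Theorems/PhotonSphereChannelsTameCensorshipRobustMono.lean): the only change is
  -- that the direction set carries one residual-membership component instead of the pair (open, dense).
  intro X _ _ _ _ _ _ d Q Q' hQ h m G hG
  obtain ⟨n, G₁, L, hL, hG₁, hLG, hR⟩ := h m G hG
  refine ⟨n, G₁, L, hL, hG₁, hLG, fun p G₂ L' hL' hG₂ hL'G => ?_⟩
  obtain ⟨U, hUr, hU⟩ := hR p G₂ L' hL' hG₂ hL'G
  refine ⟨U, hUr, fun v hv => ?_⟩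
  obtain ⟨δ, hδ, hgood⟩ := hU v hv
  exact ⟨δ, hδ, fun t ht htδ => hQ _ (hG₂.2.2.1 _) (hgood t ht htδ)⟩

end Summit.FinalStateConjecture.FinalStateConjecture.Theorems.PhotonSphereChannels.TameCensorshipUnwind

end
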